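import Summits.ResolutionOfSingularities.ResolutionOfSingularities.Theorems.HilbertSamuelEliminationSigmaMaxModificationsCorridor3WLadderIsoTailTower
import Summits.ResolutionOfSingularities.ResolutionOfSingularities.Theorems.HilbertSamuelEliminationSigmaMaxModificationsCorridor3WLadderMovingIsoDefs
import Summits.ResolutionOfSingularities.ResolutionOfSingularities.Theorems.HilbertSamuelEliminationSigmaMaxModificationsCorridor3OriginAlongReaches
import Summits.ResolutionOfSingularities.ResolutionOfSingularities.Theorems.HilbertSamuelEliminationSigmaMaxModificationsCorridor3RegularValue
import HarnessLib

/-!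
# [OURS · L1 W4.2] `IsoTailTowerExtractionM p` HOLDS — the isolated-tail tower extraction of the W-top CORE (W4.2 DEAL D7
# «ISO-TAIL EXTRACTION»; crux `SigmaMaxModifications` stmt-ResolutionOfSingularities-18506, conjunct `SigmaMaxModificationsCorridor3`
# stmt-…-19249; line `w_ladder` v6; `--supports stmt-ResolutionOfSingularities-19249`, helper)

OURS (cell res-hironaka, slot W4.2, seat res-D-pv-042 AS W4.2 DEAL hand D7); NOT statements of H. Hironaka's manuscript
[Hironaka2017] nor of [CossartJannsenSaito2020]. AI-drafted, weaker than expert review. Sorry-free PROOF file (no new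
definition), fact-free (no named fact is consumed).

`IdeasL1Idea2R4.isoTailTowerExtractionM_holds (p) : IsoTailTowerExtractionM p` (res-L1-w42-idea-2's row, typed by res-type-012 in
`…Corridor3WLadderMovingIsoDefs`, p500943 :147): a moving chain of canonical near steps from a maximal origin, all of whose stages are
ISOLATED in the Hilbert–Samuel locus with `3 ≤ ē`, yields an isolated E3 point tower `IsIsoPointTower 3 ν T pt` over a maximal origin —
the input of `wtopEvIsoM_of_towers` (p501384). ROUTE (stalk isomorphisms, not open restrictions): the STAGE TOWER of the chain from its
first genuine stage `X_{n_0}` (`Moving.exists_isoStageTower_of_movingChain`, `…Corridor3WLadderIsoTailTower`: `T.X 0 = X_{n_0}`,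
`T.X (j+1) = Bℓ_{y_j}(T.X j)`, `𝒪_{T.X j,y_j} ≅ 𝒪_{X_{n_j},x_{n_j}}`), whose base is a maximal origin by res-type-071's
`IsMaximalOrigin.of_reaches`; along the links `H^N = ν` (`hsFun_eq_of_stalkIso`) and `3 ≤ ē` (`geomDirDim_eq_of_ringEquiv`) transfer
outright, and ISOLATION transfers in three moves — localise at `x_{n_j}` (res-type-053's `BlowupTower.isIsolatedInHSMaxLocus_localize` on
the constant tower, upper semicontinuity over the field), carry across `Spec` of the link (stub-2's `isIsolatedInHSMaxLocus_spec_of_iso`),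
de-localise at `y_j` (`isIsolatedInHSMaxLocus_of_spec`) — the last needing «`ν` is never exceeded on `T.X j`» and «`(T.X j)_max` is
closed», which climb the tower by `IsBlowup.hsFun_le_of_isPermissible` (CJS Thm. 3.10 (1), tree-proved; the point centres are
permissible as `dim 𝒪 ≥ ē ≥ 3`) and CJS Lemma 2.36 (a) over the field (`Stacks07QW_field_holds`). The regular value `ν = Φ^{(3)}` is
vacuous (`IsMaximalOrigin.not_isBlownUp_of_eq_iterPSum`).

## References

* V. Cossart, U. Jannsen, S. Saito, LNM 2270 (2020): p. 107, Thm. 3.10 (1), Lemma 2.36, Def. 6.34, Def. 6.38, Def. 13.3, Rem. 6.29 (1).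
  [CossartJannsenSaito2020]
* The Stacks Project, Tags 01J7, 02NS, 07QW. [StacksProject]
-/

noncomputable section

set_option linter.dupNamespace false

open CategoryTheory CategoryTheory.Limits AlgebraicGeometry TopologicalSpace IsLocalRing
open Literature.AlgebraicGeometry.Resolution Literature.RingTheory.HilbertSamuel
open Scheme.IdealSheafData
open Literature.AlgebraicGeometry.CossartJannsenSaito2020
open Summit.ResolutionOfSingularities.ResolutionOfSingularities.Theorems.CampaignW42
open Summit.ResolutionOfSingularities.ResolutionOfSingularities.Theorems.SigmaMaxModificationsCorridor3
open Summit.ResolutionOfSingularities.ResolutionOfSingularities.Theorems.SigmaMaxModificationsCorridor3.Moving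

universe u

namespace Summit.ResolutionOfSingularities.ResolutionOfSingularities.Cruxes.SigmaMaxModifications.IdeasL1Idea2R4

/-- **A closed point with `3 ≤ ē` is a permissible centre**: `dim 𝒪 ≥ ē ≥ 3`, so `𝔪` is not a minimal prime
(`isPermissible_vanishingIdeal_singleton_iff`). [cite: CossartJannsenSaito2020, Def. 3.1 (2), Def. 2.26] -/
theorem isPermissible_singleton_of_three_le_geomDirDim {Y : Scheme.{u}} [IsLocallyNoetherian Y] {y : Y}
    (hy : IsClosed ({y} : Set Y)) (he : 3 ≤ Scheme.geomDirDim Y y) :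
    IdealSheafData.IsPermissible (vanishingIdeal (⟨{y}, hy⟩ : Closeds Y)) := by
  rw [isPermissible_vanishingIdeal_singleton_iff hy]
  intro hmin
  have h1 : ((3 : ℕ) : WithBot ℕ∞) ≤ ringKrullDim (Y.presheaf.stalk y) :=
    le_trans (by exact_mod_cast he) (Scheme.natCast_geomDirDim_le_ringKrullDim_stalk y)
  have h0 := ringKrullDim_le_zero_of_maximalIdeal_mem_minimalPrimes hmin
  have : ((3 : ℕ) : WithBot ℕ∞) ≤ 0 := h1.trans h0
  exact absurd this (by decide)

/-- **[OURS · L1 W4.2] `IsoTailTowerExtractionM p` HOLDS** (for every `p`; fact-free): a moving chain of canonical near steps from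
a maximal origin, every stage of which is ISOLATED in the Hilbert–Samuel locus of its stage with `3 ≤ ē`, yields an isolated E3
point tower over a maximal origin — the STAGE TOWER of the chain from its first genuine stage, read through the isomorphisms of
local rings at the marked points (module docstring). NOT a statement of the manuscript.
[cite: CossartJannsenSaito2020, Def. 6.34, Def. 6.38, Def. 13.3, Rem. 6.29 (1), Thm. 3.10 (1), p. 107] -/
theorem isoTailTowerExtractionM_holds (p : ℕ) : IsoTailTowerExtractionM.{u} p := by
  intro R hRf hRa ν X _ x hX c h0 hstep hGI hmov
  have hreach : ∀ n, Reaches R 3 ν (MarkedStage.init X x) (c n) := reaches_chain h0 hstep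
  -- the regular value: no marked point is ever blown up
  by_cases hν : ν = iterPSum 3 Phi
  · exfalso
    obtain ⟨m, -, hb⟩ := hmov 0
    exact hX.not_isBlownUp_of_eq_iterPSum hRf hRa hν (hreach m) (hstep m) hb
  -- the stage tower of the chain from its first genuine stage
  obtain ⟨g, T, y, -, -, -, hC, hycl, hover, hstalk, htr⟩ :=
    exists_isoStageTower_of_movingChain hRf hRa hX hν h0 hstep hmov (fun n _ => (hGI n).2)
  -- stage 0 of the tower is the reached stage `X_{n_0}`: a maximal origin (res-type-071)
  have hO : IsMaximalOrigin p 3 ν (T.X 0) (y 0) :=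
    htr (fun Y w => IsMaximalOrigin p 3 ν Y w) (hX.of_reaches hRa (hreach (g 0)))
  -- `H^N = ν` and `3 ≤ ē` at every marked point of the tower (stalk-local)
  have hH : ∀ n, Scheme.hsFun (T.X n) 3 (y n) = ν := by
    intro n
    haveI : IsLocallyNoetherian (T.X n) := T.ln n
    haveI : IsLocallyNoetherian (c (g n)).W := (c (g n)).ln
    obtain ⟨e⟩ := hstalk n
    rw [hsFun_eq_of_stalkIso e 3]
    exact Scheme.mem_hsStratum_iff.mp (Moving.pt_mem_hsStratum_of_reaches hX.mem_stratum (hreach (g n)))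
  have hE : ∀ n, 3 ≤ @Scheme.geomDirDim (T.X n) (T.ln n) (y n) := by
    intro n
    haveI : IsLocallyNoetherian (T.X n) := T.ln n
    haveI : IsLocallyNoetherian (c (g n)).W := (c (g n)).ln
    obtain ⟨e⟩ := hstalk n
    have h : 3 ≤ Literature.RingTheory.HilbertSamuel.geomDirDim ((c (g n)).W.presheaf.stalk (c (g n)).pt) :=
      (hGI (g n)).1
    change 3 ≤ Literature.RingTheory.HilbertSamuel.geomDirDim ((T.X n).presheaf.stalk (y n))
    rwa [Literature.RingTheory.HilbertSamuel.geomDirDim_eq_of_ringEquiv e.commRingCatIsoToRingEquiv] at h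
  -- the structure of the stages of the tower over the field of the origin
  obtain ⟨k, _, _, f₀, hsep, hft, hqc⟩ := hO.exists_structure
  haveI := hsep
  haveI := hft
  haveI := hqc
  obtain ⟨f, -, hf1, hf2⟩ := exists_towerStructure T f₀
  have hexc : ∀ j, Scheme.IsExcellent (T.X j) := fun j =>
    haveI := hf1 j
    Scheme.isExcellent_of_locallyOfFiniteType Stacks07QW_field_holds (f j)
  have hdim : ∀ j, topologicalKrullDim (T.X j) ≤ ((3 : ℕ) : WithBot ℕ∞) := tower_dim_le T hO.dim_le
  have hperm : ∀ j, IdealSheafData.IsPermissible (T.centreIdeal j) := by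
    intro j
    haveI : IsLocallyNoetherian (T.X j) := T.ln j
    have hcl : (⟨T.C j, T.isClosed_C j⟩ : Closeds (T.X j)) = ⟨{y j}, hycl j⟩ := Closeds.ext (hC j)
    show IdealSheafData.IsPermissible (vanishingIdeal ⟨T.C j, T.isClosed_C j⟩)
    rw [hcl]
    exact isPermissible_singleton_of_three_le_geomDirDim (hycl j) (hE j)
  have hsup : ∀ j (w : T.X j), ν ≤ Scheme.hsFun (T.X j) 3 w → Scheme.hsFun (T.X j) 3 w = ν :=
    tower_supMax T hexc hperm (fun w hw => le_antisymm (hO.maximal.2 ⟨w, rfl⟩ hw) hw)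
  -- ISOLATION at every marked point of the tower: localise, cross the link, de-localise
  have hI : ∀ n, @IsIsolatedInHSMaxLocus (T.X n) (T.ln n) 3 (y n) := by
    intro n
    haveI : IsLocallyNoetherian (T.X n) := T.ln n
    let s := c (g n)
    haveI : IsLocallyNoetherian s.W := s.ln
    -- upper semicontinuity of `H` at `x_{n_j}` along generisations (the stage is of finite type over a field)
    obtain ⟨k', _, _, hg⟩ := hX.exists_stateGood_of_reaches hRa hν (hreach (g n))
    obtain ⟨f', hf', -⟩ := hg.overField
    have hsc : ∀ w : s.W, w ⤳ s.pt → Scheme.hsFun s.W 3 w ≤ Scheme.hsFun s.W 3 s.pt :=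
      fun w hw => Scheme.hsFun_le_hsFun_of_specializes_over_field f' 3 hw
    -- (i) localise at `x_{n_j}` (constant tower on the stage)
    let T₀ : BlowupTower.{u} :=
      { X := fun _ => s.W, ln := fun _ => s.ln, C := fun _ => ∅, isClosed_C := fun _ => isClosed_empty,
        π := fun _ => 𝟙 s.W, isBlowup := fun _ => isBlowup_id_vanishingIdeal_empty s.W }
    have h1 : IsIsolatedInHSMaxLocus (Spec (s.W.presheaf.stalk s.pt)) 3 (closedPoint (s.W.presheaf.stalk s.pt)) :=
      T₀.isIsolatedInHSMaxLocus_localize s.pt 3 hsc (hGI (g n)).2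
    -- (ii) cross the link
    obtain ⟨e⟩ := hstalk n
    have h2 : IsIsolatedInHSMaxLocus (Spec ((T.X n).presheaf.stalk (y n))) 3 (closedPoint ((T.X n).presheaf.stalk (y n))) :=
      isIsolatedInHSMaxLocus_spec_of_iso e.symm 3 h1
    -- (iii) de-localise at `y_j`
    haveI := hf1 n
    haveI := hf2 n
    haveI : IsNoetherian (T.X n) := Scheme.isNoetherian_of_finiteType_over_field (f n)
    have hmaxy : y n ∈ Scheme.hsMaxLocus (T.X n) 3 := by
      rw [Scheme.mem_hsMaxLocus_iff, hH n]
      exact ⟨⟨y n, hH n⟩, fun μ ⟨w, hw⟩ hle => by subst hw; exact (hsup n w hle).le⟩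
    have hclmax : IsClosed (Scheme.hsMaxLocus (T.X n) 3) :=
      Scheme.isClosed_hsMaxLocus (fun μ => isClosed_hsStratumGE_over_field (f n) (hdim n) μ)
        (Scheme.finite_hsValues_of_isExcellent (hexc n) 3 (hsPsi_le_of_dim_le' (hdim n)))
    exact isIsolatedInHSMaxLocus_of_spec 3 (hycl n) hmaxy hclmax h2
  exact ⟨T, y, hO, hC, hover, hycl, hH, hI, hE⟩

end Summit.ResolutionOfSingularities.ResolutionOfSingularities.Cruxes.SigmaMaxModifications.IdeasL1Idea2R4

end
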